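import Summits.QuantumAdvantage.QuantumAdvantage.Theorems.CharDialNearReadSubcube
import Summits.QuantumAdvantage.QuantumAdvantage.Theorems.CharDialPastRead
import HarnessLib

/-!
# The one-read prefix face closes: `PrefixOneReadHard p` as a theorem (decomp-qadv lens-6 g14, tree part 28)

**Theorem** (`JLinPeel.prefixOneRead_hard_explicit`, prime `p ≠ 3`, every charge `c`): a strategy of the `n+1` cuts of
the form `h_g(u_{J_g}, t_g·W_{<g})` — a ONE-READ junta (`|J_g| ≤ 1`, arbitrary position: lookahead or memory) composed with
a PREFIX counter mod `p` — wins the odd-`n` parity⊕mod-3 relation on at most `(5/6)·2ⁿ` inputs once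
`n ≥ 3·(16·6912p⁵)·(10800p³) + 2`; `prefixOneRead_hard_unif` is the body of `SliceDial.PrefixOneReadHard p` (annex §33), hence
(annex §34) `PrefixOneReadHard p` and the thin core `OneReadThinHard p` are THEOREMS.

Proof = the FAR/NEAR TRICHOTOMY over read positions with sparsity modulus `L = 16·6912p⁵` (`rdr D t` = the cuts reading `t`):
* many SINGLY-read positions with a FAR LOOKAHEAD reader (`g + L ≤ t`): double counting the E3 times `m ∈ [g, t]`
  (`far_future_count`) gives a time `m` with `6912p³` positions `j ≥ m` read only by cuts `≤ m` ⟹ E3, part 25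
  (`prefixFutureRead_hard_explicit`);
* many singly-read positions with a FAR MEMORY reader (`g > t + L`): symmetrically (`far_past_count`) ⟹ E3ʳ, part 26
  (`prefixPastRead_hard_explicit`);
* otherwise (multiply-read positions are at most one more than unread ones, `card_multi_le`, since `Σ_t |rdr t| ≤ n + 1`) at
  least `≈ 7n/16` positions have ALL their readers NEAR; a residue class `P` of them mod `L` (pigeonhole) has `≥ 10800p³`
  elements and is `L`-separated, so on the subcubes with free set `P` every reader of a free bit has its segment frozen and
  part 28A (`nearReadSubcube_le` ← the E4 kernel `adaptiveSubcube_sharp` of part 27) bounds the wins by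
  `(2/3 + 5p√(12p/(|P|+1)))·2^n ≤ (5/6)·2^n` per subcube; average over the frozen assignment (`sum_card_subcube`).
Kernel-closed; imports parts 28A and 26 (hence 24, 25, 27).
-/

namespace Summit.QuantumAdvantage.AdviceFreeQNC0

open Finset AffBells22

namespace JLinPeel

open CounterLaw

/-! ## §1 Readers, and the counting lemmas of the trichotomy -/

section Comb

variable {p n : ℕ} (D : JLinData p n)

/-- the cuts READING position `t`. -/
noncomputable def rdr (t : Fin n) : Finset (Fin (n + 1)) := univ.filter fun g => readPos D g = some t

/-- one-read data: junta membership is the reading position. -/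
theorem readPos_of_mem (hJ1 : ∀ g, (D.J g).card ≤ 1) {g : Fin (n + 1)} {j : Fin n} (hj : j ∈ D.J g) :
    readPos D g = some j := by
  cases hr : readPos D g with
  | none =>
    rw [junta_of_readPos_none D hr] at hj
    exact absurd hj (by simp)
  | some j' =>
    rw [junta_of_readPos_some D hJ1 hr, mem_singleton] at hj
    rw [hj]

/-- **each cut reads at most one position**: `Σ_t |rdr t| ≤ n + 1`. -/
theorem sum_card_rdr_le : ∑ t : Fin n, (rdr D t).card ≤ n + 1 := by
  classical
  have h := card_eq_sum_card_fiberwise (s := (univ : Finset (Fin (n + 1)))) (t := (univ : Finset (Option (Fin n))))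
    (f := readPos D) (fun _ _ => mem_univ _)
  rw [card_univ, Fintype.card_fin, Fintype.sum_option] at h
  have e : ∑ t : Fin n, (rdr D t).card
      = ∑ t : Fin n, (univ.filter fun g : Fin (n + 1) => readPos D g = some t).card := rfl
  rw [e]
  omega

/-- **multiply-read positions are at most one more than unread ones.** -/
theorem card_multi_le :
    (univ.filter fun t : Fin n => 2 ≤ (rdr D t).card).card
      ≤ (univ.filter fun t : Fin n => (rdr D t).card = 0).card + 1 := by
  classical
  have h1 := sum_card_rdr_le D
  have h2 : ∀ t : Fin n, 1 + (if 2 ≤ (rdr D t).card then 1 else 0)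
      ≤ (rdr D t).card + (if (rdr D t).card = 0 then 1 else 0) := by
    intro t; split_ifs <;> omega
  have h3 := sum_le_sum fun t (_ : t ∈ (univ : Finset (Fin n))) => h2 t
  simp only [sum_add_distrib, sum_boole, sum_const, card_univ, Fintype.card_fin, smul_eq_mul, mul_one,
    Nat.cast_id] at h3
  omega

/-- **far lookahead reads are E3-rich**: if every E3 time `m` has fewer than `K` positions `j ≥ m` read only by cuts `≤ m`,
then few positions are singly read from distance `≥ L` in the past. -/
theorem far_future_count (hJ1 : ∀ g, (D.J g).card ≤ 1) (L K : ℕ) (hK : 0 < K)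
    (hc : ∀ m : ℕ, (univ.filter fun j : Fin n => m ≤ j.val ∧ ∀ g, j ∈ D.J g → g.val ≤ m).card < K) :
    (L + 1) * (univ.filter fun t : Fin n =>
        (rdr D t).card = 1 ∧ ∃ g, readPos D g = some t ∧ g.val + L ≤ t.val).card < (n + 1) * K := by
  classical
  set B₁ := univ.filter fun t : Fin n => (rdr D t).card = 1 ∧ ∃ g, readPos D g = some t ∧ g.val + L ≤ t.val with hB₁
  set T : Fin n → Finset ℕ := fun j => (range (n + 1)).filter fun m => m ≤ j.val ∧ ∀ g, j ∈ D.J g → g.val ≤ m with hT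
  -- double counting: `Σ_m |F(m)| = Σ_j |T j|`
  have hdc : ∑ m ∈ range (n + 1), (univ.filter fun j : Fin n => m ≤ j.val ∧ ∀ g, j ∈ D.J g → g.val ≤ m).card
      = ∑ j : Fin n, (T j).card := by
    simp only [hT, card_filter]
    exact sum_comm
  have hup : ∑ m ∈ range (n + 1), (univ.filter fun j : Fin n => m ≤ j.val ∧ ∀ g, j ∈ D.J g → g.val ≤ m).card
      ≤ (n + 1) * (K - 1) := by
    have := sum_le_sum fun m (_ : m ∈ range (n + 1)) => Nat.le_sub_one_of_lt (hc m)
    rwa [sum_const, card_range, smul_eq_mul] at this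
  -- each far singly-read position contributes `≥ L + 1` times
  have hper : ∀ j ∈ B₁, L + 1 ≤ (T j).card := by
    intro j hj
    rw [hB₁, mem_filter] at hj
    obtain ⟨_, h1, g₀, hg₀, hfar⟩ := hj
    have huniq : ∀ g, j ∈ D.J g → g = g₀ := by
      intro g hg
      have hg' : g ∈ rdr D j := mem_filter.2 ⟨mem_univ _, readPos_of_mem D hJ1 hg⟩
      have hg₀' : g₀ ∈ rdr D j := mem_filter.2 ⟨mem_univ _, hg₀⟩
      obtain ⟨a, ha⟩ := card_eq_one.1 h1
      rw [ha, mem_singleton] at hg' hg₀'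
      rw [hg', hg₀']
    have hsub : Icc g₀.val j.val ⊆ T j := by
      intro m hm
      rw [mem_Icc] at hm
      rw [hT, mem_filter, mem_range]
      exact ⟨by omega, hm.2, fun g hg => by rw [huniq g hg]; exact hm.1⟩
    have := card_le_card hsub
    rw [Nat.card_Icc] at this
    omega
  have hlow : (L + 1) * B₁.card ≤ ∑ j : Fin n, (T j).card :=
    calc (L + 1) * B₁.card = ∑ j ∈ B₁, (L + 1) := by rw [sum_const, smul_eq_mul, mul_comm]
      _ ≤ ∑ j ∈ B₁, (T j).card := sum_le_sum hper
      _ ≤ ∑ j : Fin n, (T j).card :=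
          sum_le_sum_of_subset_of_nonneg (filter_subset _ _) fun _ _ _ => Nat.zero_le _
  have hK' : (n + 1) * (K - 1) + (n + 1) = (n + 1) * K := by
    rw [← Nat.mul_succ, Nat.succ_eq_add_one, Nat.sub_add_cancel hK]
  omega

/-- **far memory reads are E3ʳ-rich** (the mirror image). -/
theorem far_past_count (hJ1 : ∀ g, (D.J g).card ≤ 1) (L K : ℕ) (hK : 0 < K)
    (hc : ∀ m : ℕ, (univ.filter fun j : Fin n => j.val < m ∧ ∀ g, j ∈ D.J g → m ≤ g.val).card < K) :
    (L + 1) * (univ.filter fun t : Fin n =>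
        (rdr D t).card = 1 ∧ ∃ g, readPos D g = some t ∧ t.val + L < g.val).card < (n + 1) * K := by
  classical
  set B₂ := univ.filter fun t : Fin n => (rdr D t).card = 1 ∧ ∃ g, readPos D g = some t ∧ t.val + L < g.val with hB₂
  set T : Fin n → Finset ℕ := fun j => (range (n + 1)).filter fun m => j.val < m ∧ ∀ g, j ∈ D.J g → m ≤ g.val with hT
  have hdc : ∑ m ∈ range (n + 1), (univ.filter fun j : Fin n => j.val < m ∧ ∀ g, j ∈ D.J g → m ≤ g.val).card
      = ∑ j : Fin n, (T j).card := by
    simp only [hT, card_filter]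
    exact sum_comm
  have hup : ∑ m ∈ range (n + 1), (univ.filter fun j : Fin n => j.val < m ∧ ∀ g, j ∈ D.J g → m ≤ g.val).card
      ≤ (n + 1) * (K - 1) := by
    have := sum_le_sum fun m (_ : m ∈ range (n + 1)) => Nat.le_sub_one_of_lt (hc m)
    rwa [sum_const, card_range, smul_eq_mul] at this
  have hper : ∀ j ∈ B₂, L + 1 ≤ (T j).card := by
    intro j hj
    rw [hB₂, mem_filter] at hj
    obtain ⟨_, h1, g₀, hg₀, hfar⟩ := hj
    have huniq : ∀ g, j ∈ D.J g → g = g₀ := by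
      intro g hg
      have hg' : g ∈ rdr D j := mem_filter.2 ⟨mem_univ _, readPos_of_mem D hJ1 hg⟩
      have hg₀' : g₀ ∈ rdr D j := mem_filter.2 ⟨mem_univ _, hg₀⟩
      obtain ⟨a, ha⟩ := card_eq_one.1 h1
      rw [ha, mem_singleton] at hg' hg₀'
      rw [hg', hg₀']
    have hsub : Icc (j.val + 1) g₀.val ⊆ T j := by
      intro m hm
      rw [mem_Icc] at hm
      rw [hT, mem_filter, mem_range]
      have := g₀.isLt
      exact ⟨by omega, by omega, fun g hg => by rw [huniq g hg]; exact hm.2⟩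
    have := card_le_card hsub
    rw [Nat.card_Icc] at this
    omega
  have hlow : (L + 1) * B₂.card ≤ ∑ j : Fin n, (T j).card :=
    calc (L + 1) * B₂.card = ∑ j ∈ B₂, (L + 1) := by rw [sum_const, smul_eq_mul, mul_comm]
      _ ≤ ∑ j ∈ B₂, (T j).card := sum_le_sum hper
      _ ≤ ∑ j : Fin n, (T j).card :=
          sum_le_sum_of_subset_of_nonneg (filter_subset _ _) fun _ _ _ => Nat.zero_le _
  have hK' : (n + 1) * (K - 1) + (n + 1) = (n + 1) * K := by
    rw [← Nat.mul_succ, Nat.succ_eq_add_one, Nat.sub_add_cancel hK]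
  omega

/-- **the trichotomy covers**: every position has all its readers `L`-near, or is singly read from afar (lookahead or
memory), or is multiply read. -/
theorem card_cover_le (L : ℕ) :
    n ≤ (univ.filter fun t : Fin n => ∀ g, readPos D g = some t → t.val < g.val + L ∧ g.val ≤ t.val + L).card
      + (univ.filter fun t : Fin n => (rdr D t).card = 1 ∧ ∃ g, readPos D g = some t ∧ g.val + L ≤ t.val).card
      + (univ.filter fun t : Fin n => (rdr D t).card = 1 ∧ ∃ g, readPos D g = some t ∧ t.val + L < g.val).card
      + (univ.filter fun t : Fin n => 2 ≤ (rdr D t).card).card := by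
  classical
  have hcov : (univ : Finset (Fin n)) ⊆
      (univ.filter fun t : Fin n => ∀ g, readPos D g = some t → t.val < g.val + L ∧ g.val ≤ t.val + L)
        ∪ (univ.filter fun t : Fin n => (rdr D t).card = 1 ∧ ∃ g, readPos D g = some t ∧ g.val + L ≤ t.val)
        ∪ (univ.filter fun t : Fin n => (rdr D t).card = 1 ∧ ∃ g, readPos D g = some t ∧ t.val + L < g.val)
        ∪ (univ.filter fun t : Fin n => 2 ≤ (rdr D t).card) := by
    intro t _
    simp only [mem_union, mem_filter, mem_univ, true_and]
    by_cases hA : ∀ g, readPos D g = some t → t.val < g.val + L ∧ g.val ≤ t.val + L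
    · exact Or.inl (Or.inl (Or.inl hA))
    · have : ∃ g, readPos D g = some t ∧ ¬ (t.val < g.val + L ∧ g.val ≤ t.val + L) := by
        by_contra hc
        exact hA fun g hg => by
          by_contra hn
          exact hc ⟨g, hg, hn⟩
      obtain ⟨g, hg, hfar⟩ := this
      by_cases h2 : 2 ≤ (rdr D t).card
      · exact Or.inr h2
      · have hpos : 0 < (rdr D t).card := card_pos.2 ⟨g, mem_filter.2 ⟨mem_univ _, hg⟩⟩
        have h1 : (rdr D t).card = 1 := by omega
        by_cases hl : g.val + L ≤ t.val
        · exact Or.inl (Or.inl (Or.inr ⟨h1, g, hg, hl⟩))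
        · exact Or.inl (Or.inr ⟨h1, g, hg, by omega⟩)
  calc n = (univ : Finset (Fin n)).card := by rw [card_univ, Fintype.card_fin]
    _ ≤ _ := card_le_card hcov
    _ ≤ _ := (card_union_le _ _).trans (Nat.add_le_add_right ((card_union_le _ _).trans
        (Nat.add_le_add_right (card_union_le _ _) _)) _)

/-- unread positions have all their readers near (vacuously). -/
theorem card_unread_le_near (L : ℕ) :
    (univ.filter fun t : Fin n => (rdr D t).card = 0).card
      ≤ (univ.filter fun t : Fin n => ∀ g, readPos D g = some t → t.val < g.val + L ∧ g.val ≤ t.val + L).card := by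
  refine card_le_card fun t ht => ?_
  rw [mem_filter] at ht ⊢
  refine ⟨ht.1, fun g hg => ?_⟩
  have : 0 < (rdr D t).card := card_pos.2 ⟨g, mem_filter.2 ⟨mem_univ _, hg⟩⟩
  omega

/-- residues: two distinct naturals congruent mod `L` are `≥ L` apart. -/
theorem le_sub_of_mod_eq {L i t : ℕ} (hit : i < t) (hmod : i % L = t % L) : L ≤ t - i := by
  have h0 : (t - i) % L = 0 := Nat.sub_mod_eq_zero_of_mod_eq hmod.symm
  by_contra hc
  rw [Nat.mod_eq_of_lt (not_le.1 hc)] at h0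
  omega

end Comb

/-! ## §2 The one-read prefix face -/

section Main

variable {p : ℕ} [hp : Fact p.Prime]

/-- **The one-read prefix face closes, explicit constants** (prime `p ≠ 3`; `θ = 5/6`,
`n ≥ 3·(16·6912p⁵)·(10800p³) + 2`; every charge): a one-read junta ⊕ prefix-counter strategy wins on at most `(5/6)·2ⁿ`
inputs. -/
theorem prefixOneRead_hard_explicit (hp3 : p ≠ 3) (n c : ℕ) (D : JLinData p n)
    (hpre : ∀ g, ∃ t : ZMod p, D.a g = fun i => if i.val < g.val then t else 0)
    (hJ1 : ∀ g, (D.J g).card ≤ 1)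
    (hn : 3 * (16 * (6912 * p ^ 5)) * (10800 * p ^ 3) + 2 ≤ n) :
    (winCount c D.strat : ℝ) ≤ 5 / 6 * (2 : ℝ) ^ n := by
  classical
  have h3 : ¬ 3 ∣ p := fun h => hp3 ((Nat.prime_dvd_prime_iff_eq Nat.prime_three hp.out).mp h).symm
  have hp0 : 0 < p := hp.out.pos
  -- constants
  set K₃ : ℕ := 6912 * p ^ 3 with hK₃
  set K₅ : ℕ := 6912 * p ^ 5 with hK₅
  set KE : ℕ := 10800 * p ^ 3 with hKE
  set L : ℕ := 16 * K₅ with hL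
  have hK₃pos : 0 < K₃ := by positivity
  have hK₅pos : 0 < K₅ := by positivity
  have hK35 : K₃ ≤ K₅ := Nat.mul_le_mul_left _ (Nat.pow_le_pow_right hp0 (by norm_num))
  have hLpos : 0 < L := by positivity
  -- branch E3: a rich future-read time
  by_cases hE3 : ∃ m : ℕ, K₃ ≤ (univ.filter fun j : Fin n => m ≤ j.val ∧ ∀ g, j ∈ D.J g → g.val ≤ m).card
  · exact prefixFutureRead_hard_explicit hp3 n c D hpre hJ1 hE3
  -- branch E3ʳ: a rich past-read time
  by_cases hE3r : ∃ m : ℕ, K₅ ≤ (univ.filter fun j : Fin n => j.val < m ∧ ∀ g, j ∈ D.J g → m ≤ g.val).card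
  · exact prefixPastRead_hard_explicit hp3 n c D hpre hJ1 hE3r
  -- branch E4: many positions with all readers near
  have hc3 : ∀ m : ℕ, (univ.filter fun j : Fin n => m ≤ j.val ∧ ∀ g, j ∈ D.J g → g.val ≤ m).card < K₃ :=
    fun m => not_le.1 fun h => hE3 ⟨m, h⟩
  have hc5 : ∀ m : ℕ, (univ.filter fun j : Fin n => j.val < m ∧ ∀ g, j ∈ D.J g → m ≤ g.val).card < K₅ :=
    fun m => not_le.1 fun h => hE3r ⟨m, h⟩
  have hB₁ := far_future_count D hJ1 L K₃ hK₃pos hc3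
  have hB₂ := far_past_count D hJ1 L K₅ hK₅pos hc5
  have hcov := card_cover_le D L
  have hM := card_multi_le D
  have hU := card_unread_le_near D L
  set A := univ.filter fun t : Fin n => ∀ g, readPos D g = some t → t.val < g.val + L ∧ g.val ≤ t.val + L with hA
  set X₁ := (univ.filter fun t : Fin n =>
    (rdr D t).card = 1 ∧ ∃ g, readPos D g = some t ∧ g.val + L ≤ t.val).card
  set X₂ := (univ.filter fun t : Fin n =>
    (rdr D t).card = 1 ∧ ∃ g, readPos D g = some t ∧ t.val + L < g.val).card
  have h8 : 8 * (X₁ + X₂) ≤ n := by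
    have h16 : 16 * K₅ * (X₁ + X₂) < 2 * K₅ * (n + 1) := by nlinarith
    by_contra hc
    have hc' : n + 1 ≤ 8 * (X₁ + X₂) := by omega
    have := Nat.mul_le_mul_left (2 * K₅) hc'
    nlinarith
  have hAK : L * KE ≤ A.card := by
    set Q := L * KE
    have hQ : 3 * Q + 2 ≤ n := by rw [show 3 * Q = 3 * L * KE from (mul_assoc 3 L KE).symm]; exact hn
    omega
  -- a large `L`-separated residue class of near positions
  obtain ⟨r, -, hPr⟩ := exists_le_card_fiber_of_mul_le_card_of_maps_to (s := A) (t := range L)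
    (f := fun t : Fin n => t.val % L) (fun t _ => mem_range.2 (Nat.mod_lt _ hLpos)) ⟨0, mem_range.2 hLpos⟩
    (by rw [card_range]; exact hAK)
  set P := A.filter fun t : Fin n => t.val % L = r with hPdef
  set W : Finset (Fin n) := univ \ P with hW
  have hPn : P.card ≤ n := (card_le_univ P).trans (by rw [Fintype.card_fin])
  have hWc : W.card = n - P.card := by rw [hW, card_univ_sdiff, Fintype.card_fin]
  have hnW : n - W.card = P.card := by omega
  have hmemW : ∀ t : Fin n, t ∉ W ↔ t ∈ P := fun t => by rw [hW, mem_sdiff, not_and, not_not]; simp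
  -- on the subcubes with free set `P`, every reader of a free position has its segment frozen
  have hseg : ∀ g t, readPos D g = some t → t ∉ W → ∀ i ∈ seg g t, i ∈ W := by
    intro g t hr htW i hi
    have htP := (hmemW t).1 htW
    rw [hPdef, mem_filter, hA, mem_filter] at htP
    obtain ⟨⟨_, hnear⟩, htr⟩ := htP
    have hgt := hnear g hr
    by_contra hiW
    have hiP := (hmemW i).1 hiW
    rw [hPdef, mem_filter] at hiP
    have hmod : i.val % L = t.val % L := by rw [hiP.2, htr]
    unfold seg at hi
    by_cases hle : g.val ≤ t.val
    · rw [if_pos hle, mem_filter] at hi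
      have := le_sub_of_mod_eq hi.2.2 hmod
      omega
    · rw [if_neg hle, mem_filter] at hi
      have := le_sub_of_mod_eq hi.2.1 hmod.symm
      omega
  -- the E4 bound per subcube
  have hb : ∀ b : Fin n → Bool,
      ((univ.filter fun u : Fin n → Bool => ringWinU c D.strat (subcubeMerge W b u) = true).card : ℝ)
        ≤ 5 / 6 * (2 : ℝ) ^ n := by
    intro b
    refine (nearReadSubcube_le D hpre hJ1 W b h3 hp0 hseg c).trans (mul_le_mul_of_nonneg_right ?_ (by positivity))
    rw [hnW]
    have hp1 : (1 : ℝ) ≤ p := by exact_mod_cast hp0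
    have hn' : (10800 : ℝ) * p ^ 3 ≤ (P.card : ℝ) + 1 := by
      have : ((10800 * p ^ 3 : ℕ) : ℝ) ≤ (P.card : ℝ) := by exact_mod_cast hPr
      push_cast at this; linarith
    have hpos : (0 : ℝ) < (P.card : ℝ) + 1 := by positivity
    have hfrac : (12 : ℝ) * p / ((P.card : ℝ) + 1) ≤ (1 / (30 * p)) ^ 2 := by
      rw [div_le_iff₀ hpos]
      have e : (1 / (30 * (p : ℝ))) ^ 2 * (10800 * p ^ 3) = 12 * p := by field_simp; ring
      calc (12 : ℝ) * p = (1 / (30 * (p : ℝ))) ^ 2 * (10800 * p ^ 3) := e.symm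
        _ ≤ (1 / (30 * (p : ℝ))) ^ 2 * ((P.card : ℝ) + 1) := by
            apply mul_le_mul_of_nonneg_left hn'; positivity
    have hsq : Real.sqrt (12 * p / ((P.card : ℝ) + 1)) ≤ 1 / (30 * p) := by
      calc Real.sqrt (12 * p / ((P.card : ℝ) + 1)) ≤ Real.sqrt ((1 / (30 * p)) ^ 2) := Real.sqrt_le_sqrt hfrac
        _ = 1 / (30 * p) := Real.sqrt_sq (by positivity)
    have : 5 * (p : ℝ) * Real.sqrt (12 * p / ((P.card : ℝ) + 1)) ≤ 5 * p * (1 / (30 * p)) :=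
      mul_le_mul_of_nonneg_left hsq (by positivity)
    have h16 : 5 * (p : ℝ) * (1 / (30 * p)) = 1 / 6 := by field_simp; ring
    linarith
  -- fibre counting over the frozen assignments
  have hsum := sum_card_subcube W (fun u : Fin n → Bool => ringWinU c D.strat u = true)
  have h2n : (0 : ℝ) < 2 ^ n := by positivity
  have hR : (2 : ℝ) ^ n * (winCount c D.strat : ℝ) ≤ (2 : ℝ) ^ n * (5 / 6 * 2 ^ n) := by
    have e1 : (2 : ℝ) ^ n * (winCount c D.strat : ℝ) =
        ∑ b : Fin n → Bool,
          ((univ.filter fun u : Fin n → Bool => ringWinU c D.strat (subcubeMerge W b u) = true).card : ℝ) := by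
      unfold winCount; rw [← Nat.cast_sum, hsum]; push_cast; ring
    rw [e1]
    calc _ ≤ ∑ b : Fin n → Bool, 5 / 6 * (2 : ℝ) ^ n := sum_le_sum fun b _ => hb b
      _ = (2 : ℝ) ^ n * (5 / 6 * 2 ^ n) := by
          rw [sum_const, card_univ, Fintype.card_fun, Fintype.card_bool, Fintype.card_fin]; simp
  exact le_of_mul_le_mul_left hR h2n

/-- **The one-read prefix face, uniform form** (prime `p ≠ 3`): literally the body of `SliceDial.PrefixOneReadHard p` —
`θ = 5/6`, `n₀ = 3·(16·6912p⁵)·(10800p³) + 2`. -/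
theorem prefixOneRead_hard_unif (hp3 : p ≠ 3) :
    ∃ θ : ℝ, θ < 1 ∧ ∃ n₀ : ℕ, ∀ n ≥ n₀, ∀ (c : ℕ) (D : JLinData p n),
      (∀ g, (D.J g).card ≤ 1) →
      (∀ g, ∃ t : ZMod p, D.a g = fun i => if i.val < g.val then t else 0) →
      (winCount c D.strat : ℝ) ≤ θ * (2 : ℝ) ^ n :=
  ⟨5 / 6, by norm_num, 3 * (16 * (6912 * p ^ 5)) * (10800 * p ^ 3) + 2,
    fun n hn c D hJ1 hpre => prefixOneRead_hard_explicit hp3 n c D hpre hJ1 hn⟩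

end Main

end JLinPeel

end Summit.QuantumAdvantage.AdviceFreeQNC0
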